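import Summits.ResolutionOfSingularities.ResolutionOfSingularities.Theorems.MarkedTransferCampaignW46ThreefoldsProgress
import Summits.ResolutionOfSingularities.ResolutionOfSingularities.Theorems.MarkedTransferCampaignW46ThreefoldsExhaustion
import Summits.ResolutionOfSingularities.ResolutionOfSingularities.Theorems.MarkedTransferCampaignW46StringReadingReductionSing
import Summits.ResolutionOfSingularities.ResolutionOfSingularities.Theorems.MarkedTransferCampaignW46LiteralCentreProcrastination
import HarnessLib

/-!
# [OURS · L1 W4.6 rung (ii)] EXHAUSTION: termination + progress ⇒ every state is RESOLVED BY AN `E`-PERMISSIBLE LSB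
# (Def. 2.4, tree `Hironaka2017.IsPermissibleLSB`) — Γ-free order reduction for every input of stmt-16156 (proofs)

Cell res-hironaka, LADDER-RESOLUTION rung L (D-0089), slot W4.6, rung (ii); seat res-L1-s46-pv-3 (gen 2). Host route
MarkedTransfer, host item `HypersurfaceOrderReductionDimLeThree` (stmt-16156); `--kind proof --supports` it. Companion of
`…ThreefoldsProgress` (the shapes `Progress`, `NablaStepExists`), `…ThreefoldsExhaustion` (`TerminatesNabla.induct`),
`…ThreefoldsRegime` (propagation, host states), `…StringReadingReductionSing` (final rung forms) and res-L1-s46-pv-1's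
`…LiteralCentreProcrastination` (`ResumesCover`).

HONEST FRAMING. Everything below is OURS: pure logic over the campaign shapes plus the tree's typed Def. 2.4
(`Literature.AlgebraicGeometry.Hironaka2017.IsPermissibleLSB` — a DEFINITION transcribed from the manuscript, nothing asserted)
and blow-up library. NOTHING here is a statement of H. Hironaka's manuscript (2017-03-23, [Hironaka2017]) and nothing asserts
that any statement of it holds; all shapes are HYPOTHESES. AI review is weaker than expert review.

## What (g0's HONEST LIMIT 4 — the exhaustion half — in the manuscript's own Def. 2.4 vocabulary)

* ONE STEP IS AN LSB: a step of the typed procedure (regular centre inside `Sing(E)`, blow-up) is an `E`-permissible LSB of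
  length one whose last transform is `E′` (`Step.isPermissibleLSB`).
* EXHAUSTION (`exists_isPermissibleLSB_sing_eq_empty`, general regime): `TerminatesNabla N Rd Rg` and `Progress N Rd Rg` imply
  that from every state `(A, E)` in `Rg` with a résumé read by `Rd` there are `σ : Z′ → Z` and `J′` with
  `IsPermissibleLSB E.J E.b σ J′` and `Sing(J′, b) = ∅` — `E` IS RESOLVED BY A FINITE SEQUENCE OF PERMISSIBLE BLOW-UPS
  (Noetherian induction over states, `TerminatesNabla.induct`; composition `IsPermissibleLSB.comp`).
* RUNG (ii): in regime (ii) `Progress` follows from `NablaStepExistsII` and résumé coverage of the standard unresolved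
  regime-(ii) states (`ResumesCover`), because regime (ii) and standardness propagate (`progress_regimeII`); hence
  `TerminatesNablaII → NablaStepExistsII → ResumesCover … → every standard regime-(ii) state is resolved by an LSB`
  (`exists_isPermissibleLSB_of_regimeII`), with `TerminatesNablaII` replaceable by the five shapes of ANY string reading
  (`…_of_shapes_sing`).
* HOST WORDS (`exists_isPermissibleLSB_hostState[_of_shapes]`): for every input `(k, X, I ≠ 0, m ≥ 1)` of stmt-16156 the
  hypotheses give `σ : Z′ → X`, `J′` with `IsPermissibleLSB I m σ J′` and `ord_x J′ < m` at every point of `Z′` — Γ-FREE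
  HYPERSURFACE ORDER REDUCTION in dimension `≤ 3` for the typed procedure.

HONEST LIMITS. (a) This is NOT 16156's `IsMarkedResolution`: no boundary is carried, no snc condition on the centres is
recorded (the typed Γ-free procedure has none), and Def. 2.4 LSBs allow localisation steps although the sequence built here is
a global composite of blow-ups. (b) `NablaStepExists` / `ResumesCover` / the five shapes are hypotheses about the NAMED `N`;
résumé existence is the manuscript's (row 091 `U78L2`), never constructed. (c) Vacuity as (VAC).

References: `…ThreefoldsProgress`; `…ThreefoldsExhaustion` (p481854); `…ThreefoldsRegime` (p480316); `…StringReadingReductionSing`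
(p486807); tree `Hironaka2017.PermissibleLSB` (Def. 2.4 p.6, Def. 2.1 p.5, §2.1 p.4 — transcribed definition). H. Hironaka, ms.
2017-03-23, Th. 16.13 p.87 l.26–28, §16.3 p.87 l.14–24 — scope only, under adjudication, not cited as fact. [Hironaka2017]
-/

noncomputable section

set_option linter.dupNamespace false -- mandated namespace of this single-conjunct summit

open CategoryTheory AlgebraicGeometry TopologicalSpace

namespace Summit.ResolutionOfSingularities.ResolutionOfSingularities.Theorems

namespace CampaignW46

open Literature.AlgebraicGeometry.Resolution
open Literature.AlgebraicGeometry.Hironaka2017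
open Literature.AlgebraicGeometry.Hironaka2017.S02Preliminaries
open Literature.AlgebraicGeometry.Hironaka2017.Datum
open Literature.AlgebraicGeometry.Hironaka2017.S15ARSchemes
open Literature.AlgebraicGeometry.Hironaka2017.S16Proof

universe u

variable {n : ℕ} {p : ℕ} [Fact p.Prime] {K : Type u} [Field K] [CharP K p]

/-! ## One step of the typed procedure is an `E`-permissible LSB of length one -/

section OneStep

variable {N : Notions.{u} n} {A A' : AmbientDatum p K} {E : IdealExponent A.Z} {R : Resume N A E}

/-- A step of the typed procedure — blow-up of `Z` along the regular centre `D ⊆ ∇(E) ⊆ Sing(E)` — is an `E`-permissible LSB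
of length one in the sense of the typed Def. 2.4 (`Hironaka2017.IsPermissibleLSB.single`), with last transform the ideal of
`E′` (Def. 2.1, `IdealExponent.transform`). [folklore] -/
theorem Step.isPermissibleLSB (s : Step R A') : IsPermissibleLSB E.J E.b s.π s.E'.J :=
  IsPermissibleLSB.single s.D s.π s.centre.isRegular_subscheme (fun _ hy => s.le_idealOrder_of_mem hy) s.blowup

end OneStep

/-! ## Exhaustion: termination + progress ⇒ resolution by an LSB (general regime) -/

section Exhaustion

variable {N : Notions.{u} n} {Rd : Reading p K N} {Rg : Regime p K}

/-- **EXHAUSTION THEOREM.** If the ∇-centred typed procedure terminates in the regime `Rg` (`TerminatesNabla N Rd Rg`) and can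
always continue there (`Progress N Rd Rg`: from every state with a résumé a ∇-step into `Rg` exists whose transform is
resolved or again has a résumé read by `Rd`), then every state `(A, E)` in `Rg` with a résumé read by `Rd` is RESOLVED BY AN
`E`-PERMISSIBLE LSB: there are `σ : Z′ → Z`, `J′` with `IsPermissibleLSB E.J E.b σ J′` (typed Def. 2.4: a finite composite of
blow-ups in regular centres inside the successive `Sing`, `J′` the last transform) and `Sing(J′, b) = ∅`. Proof: Noetherian
induction over states (`TerminatesNabla.induct`); one step is an LSB (`Step.isPermissibleLSB`), LSBs compose
(`IsPermissibleLSB.comp`). Nothing of the manuscript is used or asserted. [folklore] -/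
theorem exists_isPermissibleLSB_sing_eq_empty (hT : TerminatesNabla N Rd Rg) (hP : Progress N Rd Rg)
    {A : AmbientDatum p K} {E : IdealExponent A.Z} (R : Resume N A E) (hRg : Rg A E) (hRd : Rd A E R) :
    ∃ (Z' : Scheme.{u}) (σ : Z' ⟶ A.Z) (J' : Z'.IdealSheafData),
      IsPermissibleLSB E.J E.b σ J' ∧ (⟨J', E.b⟩ : IdealExponent Z').sing = ∅ := by
  refine TerminatesNabla.induct hT (fun A E _ => ∃ (Z' : Scheme.{u}) (σ : Z' ⟶ A.Z) (J' : Z'.IdealSheafData),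
      IsPermissibleLSB E.J E.b σ J' ∧ (⟨J', E.b⟩ : IdealExponent Z').sing = ∅) ?_ R hRg hRd
  intro A E R hRg hRd ih
  obtain ⟨A', s, hRg', halt⟩ := hP A E R hRg hRd
  have h1 : IsPermissibleLSB E.J E.b s.toStep.π s.toStep.E'.J := s.toStep.isPermissibleLSB
  rcases halt with hres | ⟨R', hRd'⟩
  · exact ⟨A'.Z, s.toStep.π, s.toStep.E'.J, h1, hres⟩
  · obtain ⟨Z'', τ, J'', h2, hres⟩ := ih A' s R' hRg' hRd'
    exact ⟨Z'', τ ≫ s.toStep.π, J'', h1.comp h2, hres⟩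

end Exhaustion

/-! ## Rung (ii): progress from step existence and résumé coverage; resolution of every standard regime-(ii) state -/

section RungII

variable {N : Notions.{u} n} {Rd : Reading p K N}

/-- In regime (ii) PROGRESS follows from STEP EXISTENCE and RÉSUMÉ COVERAGE of the standard unresolved regime-(ii) states:
regime (ii) and standardness propagate along every step (`Step.regimeII_transform`, `Step.isStandard_transform`), so the
transform is either resolved or a covered state. (The regime is `regimeII ⊓ standard`.) [folklore] -/
theorem progress_regimeII (hS : NablaStepExistsII N Rd)
    (hC : ResumesCover N Rd fun A E => regimeII A E ∧ E.IsStandard ∧ E.sing.Nonempty) :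
    Progress N Rd (Regime.inter regimeII fun _ E => E.IsStandard) := by
  rintro A E R ⟨hRg, hE⟩ hRd
  obtain ⟨A', ⟨s⟩⟩ := hS A E R hRg hRd
  have hRg' : regimeII A' s.toStep.E' := s.toStep.regimeII_transform hRg
  have hE' : s.toStep.E'.IsStandard := s.toStep.isStandard_transform hE
  refine ⟨A', s, ⟨hRg', hE'⟩, ?_⟩
  by_cases hres : s.toStep.E'.sing = ∅
  · exact Or.inl hres
  · obtain ⟨R', hRd'⟩ := hC A' s.toStep.E' ⟨hRg', hE', Set.nonempty_iff_ne_empty.mpr hres⟩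
    exact Or.inr ⟨R', hRd'⟩

/-- **RUNG (ii), EXHAUSTION FORM.** For the NAMED `N`, `Rd`: `TerminatesNablaII N Rd`, step existence in regime (ii)
(`NablaStepExistsII`) and résumé coverage of the standard unresolved regime-(ii) states imply that EVERY standard
threefold-hypersurface state `(A, E)` (`regimeII A E`, `E.IsStandard`) is resolved by an `E`-permissible LSB:
`∃ σ J′, IsPermissibleLSB E.J E.b σ J′ ∧ Sing(J′, b) = ∅`. (Resolved states: the empty LSB.) [folklore] -/
theorem exists_isPermissibleLSB_of_regimeII (hT : TerminatesNablaII N Rd) (hS : NablaStepExistsII N Rd)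
    (hC : ResumesCover N Rd fun A E => regimeII A E ∧ E.IsStandard ∧ E.sing.Nonempty)
    {A : AmbientDatum p K} {E : IdealExponent A.Z} (hRg : regimeII A E) (hE : E.IsStandard) :
    ∃ (Z' : Scheme.{u}) (σ : Z' ⟶ A.Z) (J' : Z'.IdealSheafData),
      IsPermissibleLSB E.J E.b σ J' ∧ (⟨J', E.b⟩ : IdealExponent Z').sing = ∅ := by
  by_cases hres : E.sing = ∅
  · exact ⟨A.Z, 𝟙 A.Z, E.J, IsPermissibleLSB.nil, hres⟩
  · obtain ⟨R, hRd⟩ := hC A E ⟨hRg, hE, Set.nonempty_iff_ne_empty.mpr hres⟩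
    have hT' : TerminatesNabla N Rd (Regime.inter regimeII fun _ E => E.IsStandard) :=
      terminatesNabla_antitone (fun _ _ h => h.1) hT
    exact exists_isPermissibleLSB_sing_eq_empty hT' (progress_regimeII hS hC) R ⟨hRg, hE⟩ hRd

/-- **RUNG (ii), EXHAUSTION FORM, FROM THE FIVE SHAPES (any string reading `σ`, monotonicity at singular points).**
[folklore] -/
theorem exists_isPermissibleLSB_of_regimeII_of_shapes (σ : StringReading p K N) (hD : σ.DecreaseShape Rd regimeII)
    (hP : σ.PrefixShape Rd regimeII) (hM : σ.StopsShape Rd regimeII) (hT : σ.TopSingShape Rd regimeII)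
    (hL : σ.MonotoneSingShape Rd regimeII) (hS : NablaStepExistsII N Rd)
    (hC : ResumesCover N Rd fun A E => regimeII A E ∧ E.IsStandard ∧ E.sing.Nonempty)
    {A : AmbientDatum p K} {E : IdealExponent A.Z} (hRg : regimeII A E) (hE : E.IsStandard) :
    ∃ (Z' : Scheme.{u}) (σ' : Z' ⟶ A.Z) (J' : Z'.IdealSheafData),
      IsPermissibleLSB E.J E.b σ' J' ∧ (⟨J', E.b⟩ : IdealExponent Z').sing = ∅ :=
  exists_isPermissibleLSB_of_regimeII (terminatesNablaII_of_shapes_sing N Rd σ hD hP hM hT hL) hS hC hRg hE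

end RungII

/-! ## In the words of the host item: Γ-free order reduction of `(X, I, m)` -/

section Host

variable {k : Type u} [Field k] [CharP k p] {N : Notions.{u} n} {Rd : Reading p k N}

/-- **Γ-FREE HYPERSURFACE ORDER REDUCTION IN DIMENSION ≤ 3 FOR THE TYPED PROCEDURE.** For the NAMED `N`, `Rd`: if
`TerminatesNablaII N Rd`, `NablaStepExistsII N Rd` and the résumés of `N` cover the standard unresolved regime-(ii) states,
then for EVERY input of stmt-16156 — `k` perfect of characteristic `p`, `X` integral regular locally of finite type
quasi-compact over `k` with `topologicalKrullDim X ≤ 3`, `I ≠ 0` effective Cartier, `m ≥ 1` — there is an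
`(I, m)`-permissible LSB `σ : Z′ → X` (typed Def. 2.4: blow-ups in regular centres inside the successive loci of order `≥ m`)
with last transform `J′` such that `ord_x J′ < m` at EVERY point of `Z′`. HONEST LIMIT: this is order reduction WITHOUT the
boundary/snc bookkeeping of 16156's `IsMarkedResolution`; 16156 itself is neither used nor derived. [folklore] -/
theorem exists_isPermissibleLSB_hostState [PerfectField k] (hT : TerminatesNablaII N Rd) (hS : NablaStepExistsII N Rd)
    (hC : ResumesCover N Rd fun A E => regimeII A E ∧ E.IsStandard ∧ E.sing.Nonempty) (X : Scheme.{u})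
    (s : X ⟶ Spec (.of k)) [LocallyOfFiniteType s] [QuasiCompact s] [IsIntegral X] (hreg : Scheme.IsRegular X)
    (hdim : topologicalKrullDim X ≤ 3) (I : X.IdealSheafData) (hI : I ≠ ⊥) (hIc : IsEffectiveCartier I) (m : ℕ)
    (hm : 1 ≤ m) :
    ∃ (Z' : Scheme.{u}) (σ : Z' ⟶ X) (J' : Z'.IdealSheafData),
      IsPermissibleLSB I m σ J' ∧ ∀ x : Z', idealOrder J' x < m := by
  obtain ⟨Z', σ, J', hσ, hres⟩ := exists_isPermissibleLSB_of_regimeII hT hS hC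
    (regimeII_hostState (p := p) X s hreg hdim I hIc m) (isStandard_hostState X I hI m hm)
  refine ⟨Z', σ, J', hσ, fun x => ?_⟩
  have hx : x ∉ (⟨J', m⟩ : IdealExponent Z').sing := by
    rw [hres]
    exact Set.notMem_empty x
  exact not_le.mp hx

/-- **Γ-FREE ORDER REDUCTION FROM THE FIVE SHAPES** (any string reading `σ`; monotonicity at singular points only): the same
conclusion for every input of stmt-16156, with `TerminatesNablaII` supplied by `terminatesNablaII_of_shapes_sing`. [folklore] -/
theorem exists_isPermissibleLSB_hostState_of_shapes [PerfectField k] (σ : StringReading p k N)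
    (hD : σ.DecreaseShape Rd regimeII) (hP : σ.PrefixShape Rd regimeII) (hM : σ.StopsShape Rd regimeII)
    (hT : σ.TopSingShape Rd regimeII) (hL : σ.MonotoneSingShape Rd regimeII) (hS : NablaStepExistsII N Rd)
    (hC : ResumesCover N Rd fun A E => regimeII A E ∧ E.IsStandard ∧ E.sing.Nonempty) (X : Scheme.{u})
    (s : X ⟶ Spec (.of k)) [LocallyOfFiniteType s] [QuasiCompact s] [IsIntegral X] (hreg : Scheme.IsRegular X)
    (hdim : topologicalKrullDim X ≤ 3) (I : X.IdealSheafData) (hI : I ≠ ⊥) (hIc : IsEffectiveCartier I) (m : ℕ)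
    (hm : 1 ≤ m) :
    ∃ (Z' : Scheme.{u}) (σ' : Z' ⟶ X) (J' : Z'.IdealSheafData),
      IsPermissibleLSB I m σ' J' ∧ ∀ x : Z', idealOrder J' x < m :=
  exists_isPermissibleLSB_hostState (terminatesNablaII_of_shapes_sing N Rd σ hD hP hM hT hL) hS hC X s hreg hdim I hI
    hIc m hm

end Host

end CampaignW46

end Summit.ResolutionOfSingularities.ResolutionOfSingularities.Theorems

end
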